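import Literature.NumberTheory.EllipticCurves.FunctionFieldEllipticLContinuationLeavesProofs
import Literature.NumberTheory.EllipticCurves.FunctionFieldEllipticLFormalConstantProofs
import HarnessLib

/-!
# `L(E, s)` over a global function field: the continuation rests on Theorem 9.3 alone

Topic `NumberTheory/EllipticCurves`. A theorems-only sibling (D-0014, D-0026: no definition, no
named fact) of `FunctionFieldEllipticLContinuationLeavesProofs`, written by the provefact seat on
`Literature.NumberTheory.EllipticCurves.analyticRank_eq_iff_finite_sha` (Tate–Milne, bsd.S33 (2))
after descending to its first prerequisite, the named fact
`Literature.NumberTheory.EllipticCurves.FunctionField.hasLContinuation_of_functionField`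
(Grothendieck; Ulmer (2011), Lecture 1, §9, arXiv p. 18: "it has a meromorphic continuation to
all `s`", "in all cases `L(E,s)` is holomorphic at `s = 1`"): every statement about
`FunctionField.analyticRank W = ord_{s=1} L(E, s)` first needs `HasLContinuation W`, since
`FunctionField.lFunction W` is a genuine continuation of the Euler product only under that
predicate (`FunctionFieldEllipticL`, `lFunction`).

`FunctionFieldEllipticLContinuationLeavesProofs` reduced the continuation to three leaves
(`hasLContinuation_of_functionField_of_schmidt_leaves`): F. K. Schmidt's `∂ = 1`
(Stichtenoth Cor. 5.1.11), the Hasse–Weil theorem (Stichtenoth Thm. 5.2.1) — both over every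
finite full constant field of `F` — and Ulmer's Theorem 9.3 for non-constant `E`
(`ellLFunction_eq_prod_of_not_isConstantCurve`, Grothendieck–Deligne). The first two are now
**theorems of the tree** (`DiophantineGeometry.AlgFunctionField.minPosDegree_eq_one_holds`,
`FunctionFieldSchmidtDegreeOneProofs`; `DiophantineGeometry.AlgFunctionField.hasseWeil_holds`,
`FunctionFieldHasseWeilProofs`), and the constant case of the continuation is unconditional
(`HasLContinuation.of_isConstantCurve`, `FunctionFieldEllipticLFormalConstantProofs`). This file
records the resulting one-leaf forms:

* `hasLContinuation_of_functionField_of_theorem93` — the named fact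
  `hasLContinuation_of_functionField Fq W` follows from Theorem 9.3 alone (quantified over the
  finite constant fields of `F`, as in the leaves file);
* `HasLContinuation.of_theorem93_of_isFullConstantField` — sharper: for an elliptic `W`, the
  single instance of Theorem 9.3 at one finite *full* constant field `k` of `F` gives
  `HasLContinuation W` (the genus datum through which the vendored Theorem 9.3 is consumable is
  Weil's theorem `isGenus_genus_holds`, the constant case is `HasLContinuation.of_isConstantCurve`);
* `hasLContinuation_of_functionField_of_theorem93_of_isFullConstantField`,
  `HasLContinuation.of_theorem93`, `lFunction_mem_lContinuations_of_theorem93`,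
  `analyticAt_lFunction_of_theorem93` — the same for the named fact, for the predicate at an
  arbitrary constant field, and for the chosen continuation `lFunction W` (so that
  `analyticRank W` and `leadingLCoeff W` are the genuine order and leading coefficient of
  `L(E, s)` at `s = 1` granted Theorem 9.3).

What remains open on this line is exactly Theorem 9.3 (the Grothendieck–Lefschetz trace formula
for `j_* V_ℓ(E)` on `𝒞` and Deligne's purity; Ulmer, Lecture 4, §§1–2), absent from Mathlib and
Literature.

## References

* [Ulmer2011ParkCity] D. Ulmer, *Elliptic curves over function fields*, IAS/Park City Math.
  Ser. 18 (2011), Lecture 1, §9, Theorem 9.3 and Exercise 9.2 (arXiv:1101.1939, p. 18).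
* [Stichtenoth2009] H. Stichtenoth, *Algebraic Function Fields and Codes*, 2nd ed., GTM 254,
  Cor. 5.1.11, Thm. 5.2.1.
* [Weil1948] A. Weil, *Sur les courbes algébriques et les variétés qui s'en déduisent*,
  Hermann 1948.
-/

noncomputable section

namespace Literature.NumberTheory.EllipticCurves.FunctionField

-- `_root_`: the import closure contains `Literature.NumberTheory.EllipticCurves.FunctionField.Polynomial`
-- (CONVENTIONS §2), which a bare `open scoped Polynomial` would pick up here.
open scoped _root_.Polynomial

variable {F : Type} [Field F]

/-! ## Theorem 9.3 at one full constant field suffices -/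

section OneConstantField

variable (k : Type) [Field k] [Fintype k]
variable [Algebra k[X] F] [Algebra (RatFunc k) F] [IsScalarTower k[X] (RatFunc k) F]
  [FunctionField k F]
variable (W : WeierstrassCurve F)

/-- **`L(E, s)` continues to `ℂ`, holomorphically at `s = 1`, granted Theorem 9.3 for `E` over the
full constant field.** Let `F ⊇ k(t)` be a global function field whose finite constant field `k`
is the *full* constant field, and `W / F` an elliptic curve. If Ulmer's Theorem 9.3 holds for `W`
over `k` (`ellLFunction_eq_prod_of_not_isConstantCurve k W`: for non-constant `E`,
`L(E, s) = ∏ (1 - αᵢ q^{-s})` is a polynomial in `q^{-s}`), then `HasLContinuation W`. Printed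
architecture (Ulmer (2011), Lecture 1, §9): constant `E` — Exercise 9.2, unconditional in the tree
(`HasLContinuation.of_isConstantCurve`); non-constant `E` — Theorem 9.3, the polynomial being
entire (`hasLContinuation_of_not_isConstantCurve`), where the genus datum `IsGenus k F g` in which
the vendored Theorem 9.3 is stated is Weil's theorem for `F/k`, a theorem of the tree
(`DiophantineGeometry.AlgFunctionField.isGenus_genus_holds`: F. K. Schmidt and Hasse–Weil).
Relies on: hypothesis `h93` only (named fact, Grothendieck–Deligne).
[cite: Ulmer2011ParkCity, Lect. 1, §9, Thm. 9.3 and Exercise 9.2] -/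
theorem HasLContinuation.of_theorem93_of_isFullConstantField [W.IsElliptic]
    (hk : IsFullConstantField k F) (h93 : ellLFunction_eq_prod_of_not_isConstantCurve k W) :
    HasLContinuation W := by
  by_cases hc : IsConstantCurve k W
  · exact HasLContinuation.of_isConstantCurve k k W hc
  · letI : Algebra k F := ((algebraMap k[X] F).comp Polynomial.C).toAlgebra
    haveI : IsScalarTower k k[X] F := IsScalarTower.of_algebraMap_eq fun c => by
      rw [RingHom.algebraMap_toAlgebra, RingHom.comp_apply, Polynomial.C_eq_algebraMap]
    haveI := isAlgFunctionField_of_functionField k F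
    haveI : IsIntegrallyClosedIn k F := (isFullConstantField_iff_isIntegrallyClosedIn k F).mp hk
    have hg := DiophantineGeometry.AlgFunctionField.isGenus_genus_holds (Fq := k) (F := F)
    exact hasLContinuation_of_not_isConstantCurve k W hk hg hc h93

variable (Fq : Type) [Field Fq] [Fintype Fq]
variable [Algebra Fq[X] F] [Algebra (RatFunc Fq) F] [IsScalarTower Fq[X] (RatFunc Fq) F]
  [FunctionField Fq F]

/-- The named fact `hasLContinuation_of_functionField Fq W` of `FunctionFieldEllipticL`, for an
arbitrary global-function-field structure `F ⊇ 𝔽_q(t)`, from the single instance of Theorem 9.3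
at a finite full constant field `k` of `F`. Relies on: hypothesis `h93` only (named fact).
[cite: Ulmer2011ParkCity, Lect. 1, §9, Thm. 9.3 and Exercise 9.2] -/
theorem hasLContinuation_of_functionField_of_theorem93_of_isFullConstantField
    (hk : IsFullConstantField k F) (h93 : ellLFunction_eq_prod_of_not_isConstantCurve k W) :
    hasLContinuation_of_functionField Fq W := by
  intro _
  exact HasLContinuation.of_theorem93_of_isFullConstantField k W hk h93

end OneConstantField

/-! ## Theorem 9.3 over the constant fields of `F`: the one-leaf form of the leaves file -/

section AllConstantFields

variable (Fq : Type) [Field Fq] [Fintype Fq]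
variable [Algebra Fq[X] F] [Algebra (RatFunc Fq) F] [IsScalarTower Fq[X] (RatFunc Fq) F]
  [FunctionField Fq F]
variable (W : WeierstrassCurve F)

/-- **`hasLContinuation_of_functionField` rests on Theorem 9.3 alone.** For a Weierstrass curve
`W` over a global function field `F ⊇ 𝔽_q(t)`, the named fact `hasLContinuation_of_functionField
Fq W` (for elliptic `W`, `L(E, s)` has a meromorphic continuation to `ℂ` holomorphic at `s = 1`;
Ulmer (2011), Lecture 1, §9) follows from Ulmer's Theorem 9.3 for non-constant `E`
(`ellLFunction_eq_prod_of_not_isConstantCurve k W`) over the finite constant fields `k` of `F`: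
this is `hasLContinuation_of_functionField_of_schmidt_leaves` with its leaves F. K. Schmidt's
`∂ = 1` (`minPosDegree_eq_one_holds`, Stichtenoth Cor. 5.1.11) and the Hasse–Weil theorem
(`hasseWeil_holds`, Stichtenoth Thm. 5.2.1) discharged in the tree. Relies on: hypothesis `h93`
only (named fact, Grothendieck–Deligne; Ulmer, Lecture 4, §§1–2).
[cite: Ulmer2011ParkCity, Lect. 1, §9, Thm. 9.3 and Exercise 9.2]
[cite: Stichtenoth2009, Cor. 5.1.11 and Thm. 5.2.1] -/
theorem hasLContinuation_of_functionField_of_theorem93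
    (h93 : ∀ (k : Type) [Field k] [Fintype k] [Algebra k[X] F] [Algebra (RatFunc k) F]
      [IsScalarTower k[X] (RatFunc k) F] [FunctionField k F],
      ellLFunction_eq_prod_of_not_isConstantCurve k W) :
    hasLContinuation_of_functionField Fq W :=
  hasLContinuation_of_functionField_of_schmidt_leaves Fq W
    (fun k _ _ _ _ _ _ _ _ _ _ =>
      DiophantineGeometry.AlgFunctionField.minPosDegree_eq_one_holds k F)
    (fun _ _ _ _ _ _ _ _ _ => DiophantineGeometry.AlgFunctionField.hasseWeil_holds) h93

include Fq in
/-- The predicate `HasLContinuation W` of `FunctionFieldEllipticL` — under which `lFunction W`,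
`analyticRank W` and `leadingLCoeff W` are the genuine continuation data of `L(E, s)` — for an
elliptic curve over a global function field, from Theorem 9.3 alone. Relies on: hypothesis `h93`
only (named fact). [cite: Ulmer2011ParkCity, Lect. 1, §9, Thm. 9.3 and Exercise 9.2] -/
theorem HasLContinuation.of_theorem93 [W.IsElliptic]
    (h93 : ∀ (k : Type) [Field k] [Fintype k] [Algebra k[X] F] [Algebra (RatFunc k) F]
      [IsScalarTower k[X] (RatFunc k) F] [FunctionField k F],
      ellLFunction_eq_prod_of_not_isConstantCurve k W) :
    HasLContinuation W :=
  hasLContinuation_of_functionField_of_theorem93 Fq W h93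

include Fq in
/-- Granted Theorem 9.3, the chosen `L`-function `lFunction W` of an elliptic curve over a global
function field is an admissible continuation of the Euler product: meromorphic on `ℂ`, analytic at
`s = 1`, and equal to `∏_v L_v(E, s)` for `Re s > 3/2`; in particular `analyticRank W` is the
order of vanishing of `L(E, s)` at `s = 1` (Ulmer (2011), Lecture 1, §§9–11). Relies on:
hypothesis `h93` only (named fact). [cite: Ulmer2011ParkCity, Lect. 1, §9, Thm. 9.3] -/
theorem lFunction_mem_lContinuations_of_theorem93 [W.IsElliptic]
    (h93 : ∀ (k : Type) [Field k] [Fintype k] [Algebra k[X] F] [Algebra (RatFunc k) F]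
      [IsScalarTower k[X] (RatFunc k) F] [FunctionField k F],
      ellLFunction_eq_prod_of_not_isConstantCurve k W) :
    lFunction W ∈ lContinuations W :=
  lFunction_mem_lContinuations W (HasLContinuation.of_theorem93 Fq W h93)

include Fq in
/-- Granted Theorem 9.3, `lFunction W` is analytic at `s = 1` for an elliptic curve over a global
function field, so `analyticRank W = analyticOrderNatAt (lFunction W) 1` carries no junk from
non-analyticity. Relies on: hypothesis `h93` only (named fact).
[cite: Ulmer2011ParkCity, Lect. 1, §9, Thm. 9.3] -/
theorem analyticAt_lFunction_of_theorem93 [W.IsElliptic]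
    (h93 : ∀ (k : Type) [Field k] [Fintype k] [Algebra k[X] F] [Algebra (RatFunc k) F]
      [IsScalarTower k[X] (RatFunc k) F] [FunctionField k F],
      ellLFunction_eq_prod_of_not_isConstantCurve k W) :
    AnalyticAt ℂ (lFunction W) 1 :=
  (lFunction_mem_lContinuations_of_theorem93 Fq W h93).2.1

end AllConstantFields

end Literature.NumberTheory.EllipticCurves.FunctionField

end
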